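import Summits.ResolutionOfSingularities.ResolutionOfSingularities.Theses.RisoStrata
import Summits.ResolutionOfSingularities.ResolutionOfSingularities.Theorems.WeightedThesis.Negative.LoadBearing
import Mathlib.FieldTheory.Finite.GaloisField

/-!
# `DescentAlgclosedToPerfect` — negative lemmas II: load-bearing hypotheses of the consequent,
# irrefutability, shape of a counterexample, and the degree obstruction

Support (negative) lemmas for the shared crux `stmt-ResolutionOfSingularities-0550`
(`Summit.ResolutionOfSingularities.ResolutionOfSingularities.Theses.RisoStrata.DescentAlgclosedToPerfect`,
`rfl`-equal to the copies in routes Descent / UniformComplexity / EquisingularLift / TropicalLinks /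
AbhyankarShadows / TeissierJung): for every prime `p`,

  `Antecedent p` := every reduced separated scheme of finite type over every ALGEBRAICALLY CLOSED
  field of characteristic `p` has a resolution of singularities, implies
  `Consequent p` := the same over every PERFECT field of characteristic `p`.

Filed by the standing disprover (cdisprove gen 1; work file
`Cruxes/DescentAlgclosedToPerfect/Disproof.lean`; companion file
`Negative/AntecedentNonVacuity.lean`: the antecedent with `IsReduced` / `LocallyOfFiniteType`
dropped is false, so those mutations make the crux vacuous). The file declares NO definition: the
two displayed statements and every dropped-hypothesis variant are written out inline.

## Findings (all sorry-free)

* §2 THE CONSEQUENT'S HYPOTHESES. With `IsReduced X` or `LocallyOfFiniteType f` dropped from the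
  consequent, the crux becomes equivalent to the failure of the antecedent at EVERY prime
  (`…_without_isReduced_consequent_iff`, `…_without_locallyOfFiniteType_consequent_iff`; witnesses
  `Spec 𝔽_p[ε]`, `Spec 𝔽_p[X]⁺` from `Theorems.WeightedThesis.Negative`) — false as soon as
  resolution holds over the algebraically closed fields of one characteristic. With
  `[PerfectField k]` dropped it is `DescentAlgclosedToPerfect ∧ DescentPerfectToAll`
  (`…_without_perfectField_consequent_iff`): the two shared descent cruxes are exactly the
  factorisation of "algebraically closed ⇒ every field" through perfect fields. Replacing
  `[IsAlgClosed k]` by `[PerfectField k]` in the antecedent gives a tautology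
  (`descentAlgclosedToPerfect_with_perfectField_antecedent`; `antecedent_of_consequent`):
  algebraic closedness of the ground fields in the antecedent carries the whole content.
  `p.Prime` is decoration modulo Hironaka (`…_without_prime_iff`,
  `antecedent_imp_consequent_zero_of_hironaka`).
* §3 IRREFUTABILITY. `¬ DescentAlgclosedToPerfect ↔ ∃ p prime, Antecedent p ∧ ¬ Consequent p`
  (`not_descentAlgclosedToPerfect_iff`): a refutation must PROVE resolution over all
  algebraically closed fields of some characteristic (open from dimension 4) and exhibit a
  non-resolvable variety over a perfect field; the ground field of such a counterexample is NOT
  algebraically closed (`not_isAlgClosed_of_antecedent_of_not_hasResolution`); modulo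
  `CossartPiltant2019` the counterexample is an integral closed subscheme of some `ℙⁿ_k` of
  dimension `≥ 4` over a perfect, not algebraically closed `k`
  (`consequent_iff_minimalCase`, `not_descentAlgclosedToPerfect_iff_minimalCase`). No finite or
  computable falsifier exists; refuting the crux would refute the summit.
* §4 THE DEGREE OBSTRUCTION (why the antecedent does not transfer naively). Smallest instance of
  "for geometrically integral `X`, a resolution `Y → X_L` composed with the projection `X_L → X`
  of a non-trivial finite separable base extension is an alteration of degree `[L:k]`, never
  birational": for `X = Spec 𝔽_p`,
  `L = 𝔽_{p²}`, NO morphism `Y → Spec 𝔽_{p²}` becomes birational onto `Spec 𝔽_p` after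
  composition (`not_isBirational_comp_galoisField_two`), so none is a resolution of `Spec 𝔽_p`
  (`not_isResolution_comp_galoisField_two`). Descent of a resolution from `k̄` (or a finite Galois
  `L/k`) to a perfect `k` needs a Galois-STABLE resolution upstairs; the printed descents
  (Kollár 2007, 3.34.2 / Thm. 3.36; Bierstone–Grigoriev–Milman–Włodarczyk 2011, Remark p. 23)
  take it from functoriality of a resolution ALGORITHM, which bare existence does not supply.

## Sources
* J. Kollár, *Lectures on Resolution of Singularities*, Ann. of Math. Stud. 166 (2007), 3.34.2
  and Thm. 3.36 (change of fields for functorial resolution).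
* E. Bierstone, D. Grigoriev, P. Milman, J. Włodarczyk, *Effective Hironaka resolution and its
  complexity*, Asian J. Math. 15 (2011), Remark p. 23 (arXiv:1206.3090).
* V. Cossart, O. Piltant, J. Algebra 529 (2019), Thm. 1.1 (named fact `CossartPiltant2019`).
* The Stacks Project, Tag 01RN (birational), Tag 02IS (regular).
* Tree: `Theorems/WeightedThesis/Negative/LoadBearing.lean` (witnesses, minimal case),
  `ChowLemmaIntegral_holds`, `exists_projectiveClosure`; the reductions are folklore.
-/

noncomputable section

open CategoryTheory AlgebraicGeometry TopologicalSpace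
open Literature.AlgebraicGeometry.Resolution
open Summit.ResolutionOfSingularities.ResolutionOfSingularities.Theses.RisoStrata

set_option linter.dupNamespace false -- mandated namespace of this single-conjunct summit

namespace Summit.ResolutionOfSingularities.ResolutionOfSingularities.Theorems.DescentAlgclosedToPerfect.Negative

/-! ## §0 The crux unfolded: `∀ p prime, Antecedent p → Consequent p` -/

/-- The crux, displayed: for every prime `p`, resolution of every reduced separated finite-type
scheme over every algebraically closed field of characteristic `p` implies the same over every
perfect field of characteristic `p`. [folklore] -/
theorem descentAlgclosedToPerfect_iff :
    DescentAlgclosedToPerfect ↔ ∀ p : ℕ, p.Prime →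
      (∀ (k : Type) [Field k] [CharP k p] [IsAlgClosed k] (X : Scheme.{0})
          (f : X ⟶ Spec (.of k)), IsSeparated f → LocallyOfFiniteType f → QuasiCompact f →
            IsReduced X → Scheme.HasResolution X) →
        ∀ (k : Type) [Field k] [CharP k p] [PerfectField k] (X : Scheme.{0})
          (f : X ⟶ Spec (.of k)), IsSeparated f → LocallyOfFiniteType f → QuasiCompact f →
            IsReduced X → Scheme.HasResolution X :=
  Iff.rfl

/-! ## §2 The consequent's hypotheses -/

/-- **With `IsReduced X` dropped from the CONSEQUENT, the crux is equivalent to the failure of the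
antecedent at every prime** (the mutated consequent is refuted by `Spec 𝔽_p[ε]`,
`weightedThesis_false_without_isReduced_at`): `IsReduced` on the right is load-bearing as soon as
resolution holds over the algebraically closed fields of one characteristic. [folklore] -/
theorem descentAlgclosedToPerfect_without_isReduced_consequent_iff :
    (∀ p : ℕ, p.Prime →
      (∀ (k : Type) [Field k] [CharP k p] [IsAlgClosed k] (X : Scheme.{0})
          (f : X ⟶ Spec (.of k)), IsSeparated f → LocallyOfFiniteType f → QuasiCompact f →
            IsReduced X → Scheme.HasResolution X) →
        ∀ (k : Type) [Field k] [CharP k p] [PerfectField k] (X : Scheme.{0})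
          (f : X ⟶ Spec (.of k)), IsSeparated f → LocallyOfFiniteType f → QuasiCompact f →
            Scheme.HasResolution X) ↔
    ∀ p : ℕ, p.Prime →
      ¬ ∀ (k : Type) [Field k] [CharP k p] [IsAlgClosed k] (X : Scheme.{0})
          (f : X ⟶ Spec (.of k)), IsSeparated f → LocallyOfFiniteType f → QuasiCompact f →
            IsReduced X → Scheme.HasResolution X := by
  refine ⟨fun h p hp hA => ?_, fun h p hp hA => absurd hA (h p hp)⟩
  haveI : Fact p.Prime := ⟨hp⟩
  exact WeightedThesis.Negative.weightedThesis_false_without_isReduced_at p (h p hp hA)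

/-- **With `LocallyOfFiniteType f` dropped from the CONSEQUENT, the crux is equivalent to the
failure of the antecedent at every prime** (the mutated consequent is refuted by `Spec 𝔽_p[X]⁺`,
`weightedThesis_false_without_locallyOfFiniteType_at`). [folklore] -/
theorem descentAlgclosedToPerfect_without_locallyOfFiniteType_consequent_iff :
    (∀ p : ℕ, p.Prime →
      (∀ (k : Type) [Field k] [CharP k p] [IsAlgClosed k] (X : Scheme.{0})
          (f : X ⟶ Spec (.of k)), IsSeparated f → LocallyOfFiniteType f → QuasiCompact f →
            IsReduced X → Scheme.HasResolution X) →
        ∀ (k : Type) [Field k] [CharP k p] [PerfectField k] (X : Scheme.{0})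
          (f : X ⟶ Spec (.of k)), IsSeparated f → QuasiCompact f → IsReduced X →
            Scheme.HasResolution X) ↔
    ∀ p : ℕ, p.Prime →
      ¬ ∀ (k : Type) [Field k] [CharP k p] [IsAlgClosed k] (X : Scheme.{0})
          (f : X ⟶ Spec (.of k)), IsSeparated f → LocallyOfFiniteType f → QuasiCompact f →
            IsReduced X → Scheme.HasResolution X := by
  refine ⟨fun h p hp hA => ?_, fun h p hp hA => absurd hA (h p hp)⟩
  haveI : Fact p.Prime := ⟨hp⟩
  exact WeightedThesis.Negative.weightedThesis_false_without_locallyOfFiniteType_at p (h p hp hA)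

/-- **With `[PerfectField k]` dropped from the CONSEQUENT, the crux is
`DescentAlgclosedToPerfect ∧ DescentPerfectToAll`**: the two shared descent cruxes are exactly the
factorisation of "algebraically closed ⇒ every field of characteristic `p`" through perfect
fields (perfect-field resolution gives back the algebraically closed case for free).
[folklore] -/
theorem descentAlgclosedToPerfect_without_perfectField_consequent_iff :
    (∀ p : ℕ, p.Prime →
      (∀ (k : Type) [Field k] [CharP k p] [IsAlgClosed k] (X : Scheme.{0})
          (f : X ⟶ Spec (.of k)), IsSeparated f → LocallyOfFiniteType f → QuasiCompact f →
            IsReduced X → Scheme.HasResolution X) →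
        ResolutionInChar.{0} p) ↔
    DescentAlgclosedToPerfect ∧ DescentPerfectToAll :=
  ⟨fun h => ⟨fun p hp hA k _ _ _ X f hs hl hq hr => h p hp hA k X f hs hl hq hr,
      fun p hp hP => h p hp fun k _ _ _ X f hs hl hq hr => hP k X f hs hl hq hr⟩,
    fun ⟨hC, hD⟩ p hp hA => hD p hp (hC p hp hA)⟩

/-- **With `[IsAlgClosed k]` replaced by `[PerfectField k]` in the ANTECEDENT the crux is a
tautology**: algebraic closedness of the ground fields in the antecedent carries the whole content
of the crux (an algebraically closed field is perfect, so the consequent always gives back the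
antecedent). [folklore] -/
theorem descentAlgclosedToPerfect_with_perfectField_antecedent :
    ∀ p : ℕ, p.Prime →
      (∀ (k : Type) [Field k] [CharP k p] [PerfectField k] (X : Scheme.{0})
          (f : X ⟶ Spec (.of k)), IsSeparated f → LocallyOfFiniteType f → QuasiCompact f →
            IsReduced X → Scheme.HasResolution X) →
        ∀ (k : Type) [Field k] [CharP k p] [PerfectField k] (X : Scheme.{0})
          (f : X ⟶ Spec (.of k)), IsSeparated f → LocallyOfFiniteType f → QuasiCompact f →
            IsReduced X → Scheme.HasResolution X :=
  fun _ _ h => h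

/-- The consequent implies the antecedent at each `p` (an algebraically closed field is perfect):
the crux says the two are EQUIVALENT prime by prime. [folklore] -/
theorem antecedent_of_consequent (p : ℕ)
    (h : ∀ (k : Type) [Field k] [CharP k p] [PerfectField k] (X : Scheme.{0})
      (f : X ⟶ Spec (.of k)), IsSeparated f → LocallyOfFiniteType f → QuasiCompact f →
        IsReduced X → Scheme.HasResolution X) :
    ∀ (k : Type) [Field k] [CharP k p] [IsAlgClosed k] (X : Scheme.{0})
      (f : X ⟶ Spec (.of k)), IsSeparated f → LocallyOfFiniteType f → QuasiCompact f →
        IsReduced X → Scheme.HasResolution X :=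
  fun k _ _ _ X f hs hl hq hr => h k X f hs hl hq hr

/-- **With `p.Prime` dropped, the crux is itself plus its `p = 0` clause** (no field has
characteristic `1` or a composite characteristic). [folklore] -/
theorem descentAlgclosedToPerfect_without_prime_iff :
    (∀ p : ℕ,
      (∀ (k : Type) [Field k] [CharP k p] [IsAlgClosed k] (X : Scheme.{0})
          (f : X ⟶ Spec (.of k)), IsSeparated f → LocallyOfFiniteType f → QuasiCompact f →
            IsReduced X → Scheme.HasResolution X) →
        ∀ (k : Type) [Field k] [CharP k p] [PerfectField k] (X : Scheme.{0})
          (f : X ⟶ Spec (.of k)), IsSeparated f → LocallyOfFiniteType f → QuasiCompact f →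
            IsReduced X → Scheme.HasResolution X) ↔
    DescentAlgclosedToPerfect ∧
      ((∀ (k : Type) [Field k] [CharP k 0] [IsAlgClosed k] (X : Scheme.{0})
          (f : X ⟶ Spec (.of k)), IsSeparated f → LocallyOfFiniteType f → QuasiCompact f →
            IsReduced X → Scheme.HasResolution X) →
        ∀ (k : Type) [Field k] [CharP k 0] [PerfectField k] (X : Scheme.{0})
          (f : X ⟶ Spec (.of k)), IsSeparated f → LocallyOfFiniteType f → QuasiCompact f →
            IsReduced X → Scheme.HasResolution X) := by
  refine ⟨fun h => ⟨fun p _ => h p, h 0⟩, fun ⟨h, h0⟩ p hA k _ _ _ X f hs hl hq hr => ?_⟩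
  rcases CharP.char_is_prime_or_zero k p with hp | rfl
  · exact h p hp hA k X f hs hl hq hr
  · exact h0 hA k X f hs hl hq hr

/-- The `p = 0` clause is Hironaka's theorem (named fact `Hironaka1964`, weak form): `p.Prime` is
decoration modulo it. [cite: Hironaka1964, Main Theorem I] -/
theorem antecedent_imp_consequent_zero_of_hironaka (h0 : Hironaka1964.{0}) :
    (∀ (k : Type) [Field k] [CharP k 0] [IsAlgClosed k] (X : Scheme.{0})
        (f : X ⟶ Spec (.of k)), IsSeparated f → LocallyOfFiniteType f → QuasiCompact f →
          IsReduced X → Scheme.HasResolution X) →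
      ∀ (k : Type) [Field k] [CharP k 0] [PerfectField k] (X : Scheme.{0})
        (f : X ⟶ Spec (.of k)), IsSeparated f → LocallyOfFiniteType f → QuasiCompact f →
          IsReduced X → Scheme.HasResolution X :=
  fun _ k _ _ _ X f hs hl hq hr => h0 k X f hs hl hq hr

/-! ## §3 Irrefutability and the shape of a counterexample -/

/-- **`¬ DescentAlgclosedToPerfect` unfolds to: some prime `p` with resolution over ALL
algebraically closed fields of characteristic `p` AND a failure of resolution over some perfect
field of characteristic `p`** — both halves are open; the crux is unfalsifiable by instances.
[folklore] -/
theorem not_descentAlgclosedToPerfect_iff :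
    ¬ DescentAlgclosedToPerfect ↔ ∃ p : ℕ, p.Prime ∧
      (∀ (k : Type) [Field k] [CharP k p] [IsAlgClosed k] (X : Scheme.{0})
          (f : X ⟶ Spec (.of k)), IsSeparated f → LocallyOfFiniteType f → QuasiCompact f →
            IsReduced X → Scheme.HasResolution X) ∧
      ¬ ∀ (k : Type) [Field k] [CharP k p] [PerfectField k] (X : Scheme.{0})
          (f : X ⟶ Spec (.of k)), IsSeparated f → LocallyOfFiniteType f → QuasiCompact f →
            IsReduced X → Scheme.HasResolution X := by
  rw [descentAlgclosedToPerfect_iff]; push Not; rfl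

/-- **Once the antecedent holds at `p`, the ground field of a counterexample to the consequent is
NOT algebraically closed** (else the antecedent resolves it): the first instance with content is
descent from `𝔽̄_p` to a finite field. [folklore] -/
theorem not_isAlgClosed_of_antecedent_of_not_hasResolution {p : ℕ}
    (hA : ∀ (k : Type) [Field k] [CharP k p] [IsAlgClosed k] (X : Scheme.{0})
      (f : X ⟶ Spec (.of k)), IsSeparated f → LocallyOfFiniteType f → QuasiCompact f →
        IsReduced X → Scheme.HasResolution X)
    (k : Type) [Field k] [CharP k p] (X : Scheme.{0}) (f : X ⟶ Spec (.of k)) [IsSeparated f]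
    [LocallyOfFiniteType f] [QuasiCompact f] [IsReduced X] (hX : ¬ Scheme.HasResolution X) :
    ¬ IsAlgClosed k := fun halg => by
  haveI := halg
  exact hX (hA k X f ‹_› ‹_› ‹_› ‹_›)

/-- The consequent at one prime is equivalent, modulo `CossartPiltant2019`, to its case of INTEGRAL
CLOSED subschemes of `ℙⁿ_k` of dimension `> 3` (components glue, Chow's lemma, projective closure,
dimension `≤ 3` by Cossart–Piltant; the per-prime form of
`WeightedThesis.Negative.weightedThesis_iff_minimalCase`). [folklore] -/
theorem consequent_iff_minimalCase (hCP : CossartPiltant2019.{0}) (p : ℕ) :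
    (∀ (k : Type) [Field k] [CharP k p] [PerfectField k] (X : Scheme.{0})
        (f : X ⟶ Spec (.of k)), IsSeparated f → LocallyOfFiniteType f → QuasiCompact f →
          IsReduced X → Scheme.HasResolution X) ↔
    ∀ (k : Type) [Field k] [CharP k p] [PerfectField k] (n : ℕ) (X : Scheme.{0})
        (ι : X ⟶ (Literature.AlgebraicGeometry.Motives.projectiveSpace n k).left),
        IsClosedImmersion ι → IsIntegral X → ¬ topologicalKrullDim X ≤ 3 →
          Scheme.HasResolution X := by
  have key : ∀ (k : Type) [Field k] (n : ℕ) (X : Scheme.{0})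
      (ι : X ⟶ (Literature.AlgebraicGeometry.Motives.projectiveSpace n k).left),
      IsClosedImmersion ι → IsIntegral X →
        IsSeparated (ι ≫ (Literature.AlgebraicGeometry.Motives.projectiveSpace n k).hom) ∧
        LocallyOfFiniteType (ι ≫ (Literature.AlgebraicGeometry.Motives.projectiveSpace n k).hom) ∧
        QuasiCompact (ι ≫ (Literature.AlgebraicGeometry.Motives.projectiveSpace n k).hom) ∧
        IsReduced X := by
    intro k _ n X ι hι hint
    haveI := hι
    haveI := hint
    haveI : IsProper (Literature.AlgebraicGeometry.Motives.projectiveSpace n k).hom :=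
      Literature.AlgebraicGeometry.Motives.isProper_projectiveSpace n k
    exact ⟨inferInstance, inferInstance, inferInstance, inferInstance⟩
  constructor
  · intro h k _ _ _ n X ι hι hint _
    obtain ⟨h1, h2, h3, h4⟩ := key k n X ι hι hint
    exact h k X _ h1 h2 h3 h4
  · intro h k _ _ _ X f hsep hft hqc hred
    refine hasResolution_of_forall_closeds X f fun Z hZ => ?_
    obtain ⟨n, X', π, ι, hint', hι, hπ, -, -, U, hU, hU', hiso⟩ :=
      ChowLemmaIntegral_holds k _ ((Scheme.IdealSheafData.vanishingIdeal Z).subschemeι ≫ f)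
        inferInstance inferInstance inferInstance hZ
    haveI := hπ
    haveI := hι
    haveI := hint'
    refine Scheme.HasResolution.of_isBirational π ⟨U, hU, hU', hiso⟩ ?_
    obtain ⟨Xbar, j, c, hXbar, hj, hc, -, hdimbar⟩ := exists_projectiveClosure ι
    haveI := hj
    refine Scheme.HasResolution.of_isOpenImmersion j ?_
    by_cases hdim : topologicalKrullDim Xbar ≤ 3
    · obtain ⟨h1, h2, h3, h4⟩ := key k n Xbar c hc hXbar
      exact hCP k Xbar _ h1 h2 h3 h4 hdim
    · exact h k n Xbar c hc hXbar hdim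

/-- **SHAPE OF A REFUTATION (modulo `CossartPiltant2019`).** `¬ DescentAlgclosedToPerfect` holds
iff for some prime `p`: resolution holds over EVERY algebraically closed field of characteristic
`p`, AND there is an integral closed subscheme of some `ℙⁿ_k`, of dimension `≥ 4`, over a perfect
field `k` of characteristic `p` that is NOT algebraically closed, admitting no proper birational
morphism from a regular scheme. Neither half is available in print; no finite or computable
falsifier exists. [folklore] -/
theorem not_descentAlgclosedToPerfect_iff_minimalCase (hCP : CossartPiltant2019.{0}) :
    ¬ DescentAlgclosedToPerfect ↔ ∃ p : ℕ, p.Prime ∧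
      (∀ (k : Type) [Field k] [CharP k p] [IsAlgClosed k] (X : Scheme.{0})
          (f : X ⟶ Spec (.of k)), IsSeparated f → LocallyOfFiniteType f → QuasiCompact f →
            IsReduced X → Scheme.HasResolution X) ∧
      ∃ (k : Type) (_ : Field k) (_ : CharP k p) (_ : PerfectField k), ¬ IsAlgClosed k ∧
        ∃ (n : ℕ) (X : Scheme.{0})
          (ι : X ⟶ (Literature.AlgebraicGeometry.Motives.projectiveSpace n k).left),
          IsClosedImmersion ι ∧ IsIntegral X ∧ ¬ topologicalKrullDim X ≤ 3 ∧
            ¬ Scheme.HasResolution X := by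
  constructor
  · intro hnot
    obtain ⟨p, hp, hA, hC⟩ := not_descentAlgclosedToPerfect_iff.mp hnot
    refine ⟨p, hp, hA, ?_⟩
    by_contra hcon
    refine hC ((consequent_iff_minimalCase hCP p).mpr fun k _ _ _ n X ι hι hint hdim => ?_)
    by_contra hX
    haveI := hι
    haveI := hint
    haveI : IsProper (Literature.AlgebraicGeometry.Motives.projectiveSpace n k).hom :=
      Literature.AlgebraicGeometry.Motives.isProper_projectiveSpace n k
    refine hcon ⟨k, ‹Field k›, ‹CharP k p›, ‹PerfectField k›,
      not_isAlgClosed_of_antecedent_of_not_hasResolution hA k X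
        (ι ≫ (Literature.AlgebraicGeometry.Motives.projectiveSpace n k).hom) hX, ?_⟩
    exact ⟨n, X, ι, hι, hint, hdim, hX⟩
  · rintro ⟨p, hp, hA, k, _, _, _, -, hrest⟩ hC
    obtain ⟨n, X, ι, hι, hint, hdim, hX⟩ := hrest
    exact hX ((consequent_iff_minimalCase hCP p).mp (hC p hp hA) k n X ι hι hint hdim)

/-! ## §4 The degree obstruction: base extension is not birational -/

/-- **No morphism `Y → Spec 𝔽_{p²}` becomes birational onto `Spec 𝔽_p` after composing with
`Spec 𝔽_{p²} → Spec 𝔽_p`.** (The only dense open of `Spec 𝔽_p` is everything, so birational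
means isomorphism; then `Spec 𝔽_p ≅ Y → Spec 𝔽_{p²}` is a ring map `𝔽_{p²} → 𝔽_p`, injective as
a map of fields — impossible, `p² > p`.) The smallest instance of the degree obstruction: for
geometrically integral `X`, a resolution of `X_L` composed with the projection `X_L → X` of a
non-trivial finite separable base extension is an alteration of degree `[L:k]`, not a resolution
of `X` (geometric integrality matters: `X = Spec L` over `k` is resolved by one component of
`X_L = Spec (L ⊗ₖ L)`). [folklore] -/
theorem not_isBirational_comp_galoisField_two (p : ℕ) [Fact p.Prime] (Y : Scheme.{0})
    (g : Y ⟶ Spec (.of (GaloisField p 2))) :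
    ¬ IsBirational (g ≫ Spec.map (CommRingCat.ofHom (algebraMap (ZMod p) (GaloisField p 2)))) := by
  rintro ⟨U, hUd, -, hiso⟩
  set π := g ≫ Spec.map (CommRingCat.ofHom (algebraMap (ZMod p) (GaloisField p 2))) with hπ
  -- the only dense open of the one-point space `Spec 𝔽_p` is `⊤`
  have hU : U = ⊤ := by
    obtain ⟨x, hx⟩ := hUd.nonempty
    ext y
    simp only [Opens.coe_top, Set.mem_univ, iff_true]
    rwa [Subsingleton.elim y x]
  subst hU
  -- so `π` is an isomorphism
  haveI : IsIso π := by
    have := (IsZariskiLocalAtTarget.iff_of_iSup_eq_top (P := MorphismProperty.isomorphisms Scheme)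
      (f := π) (fun _ : Unit => (⊤ : (Spec (.of (ZMod p))).Opens)) (by simp)).mpr
      fun _ => (MorphismProperty.isomorphisms.iff _).mpr hiso
    exact (MorphismProperty.isomorphisms.iff _).mp this
  -- whence a ring map `𝔽_{p²} → 𝔽_p`
  let φ : GaloisField p 2 →+* ZMod p := (Spec.preimage (inv π ≫ g)).hom
  have h1 := Nat.card_le_card_of_injective φ φ.injective
  rw [GaloisField.card p 2 two_ne_zero, Nat.card_zmod] at h1
  have hp := (Fact.out : p.Prime).two_le
  nlinarith

/-- **Hence no `Y → Spec 𝔽_{p²} → Spec 𝔽_p` is a resolution of `Spec 𝔽_p`** (which is its own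
resolution): resolutions do not transfer down a non-trivial finite base extension by composition.
[folklore] -/
theorem not_isResolution_comp_galoisField_two (p : ℕ) [Fact p.Prime] (Y : Scheme.{0})
    (g : Y ⟶ Spec (.of (GaloisField p 2))) :
    ¬ IsResolution (g ≫ Spec.map (CommRingCat.ofHom (algebraMap (ZMod p) (GaloisField p 2)))) :=
  fun h => not_isBirational_comp_galoisField_two p Y g h.isBirational

end Summit.ResolutionOfSingularities.ResolutionOfSingularities.Theorems.DescentAlgclosedToPerfect.Negative

end
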